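import Mathlib.Tactic
import Mathlib.Order.Preorder.Finite
import HarnessLib
import HarnessLib.Audit.Tags
import Summits.CriticalPhenomena.PercolationContinuityZ3.Theorems.PercNearOneGluingNoHeavyLowerTailSahiRainbowAbsorption
import Summits.CriticalPhenomena.PercolationContinuityZ3.Theorems.PercNearOneGluingNoHeavyLowerTailSahiAntichainMeetsOrJoins

/-!
# The rainbow lemma via the antichain of MAXIMAL members: no absorption, no differences

Support file (seat `prim-masterthm-p1`, gen 39; `--supports stmt-CriticalPhenomena-4575`).  One typed statement, unconditional
reductions and an unconditional partial result; no `sorry`, standard axioms.  Memo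
`run/shared/lean/prim/prim-masterthm/FROM-prim-masterthm-p1-g39-MAX-ACCOUNTING.md`.

SETTING (`…SahiPartitionDaykin`, `…SahiRainbowIsolated`): `P ⊆ 2^F` complement-free (`F \ S ∉ P` for `S ∈ P`);
`rainbowMeets F P = {∅} ∪ {a ∩ b} ∪ {F \ (a ∪ b)}` over distinct members; the RAINBOW LEMMA (`RainbowMeetCojoin`, OPEN) asks
`#P ≤ #rainbowMeets F P`.  Gen 34–38 reduced it to an absorption-robust count for the ISOLATED members (`AntichainAbsorptionRainbow`),
in which comparable members are paid by themselves or their complements and then eat colours of the isolated antichain, which must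
be repaid by differences.

NEW HERE ([this work], gen 39): a different accounting that needs NO differences.  Let `A = maxMembers P` (the maximal members — a
complement-free antichain containing every isolated member), `Low = P \ A`.
* every `l ∈ Low` is its own colour (`l = l ∩ b` for a member `b ⊋ l`), and `Low` is disjoint from the complements of members;
* a maximal member `a` with `F \ a ∈ rainbowMeets F A` is paid by `F \ a`;
* a maximal member `a` that is NOT minimal in `P` (some member lies strictly below it) is paid by `F \ a = F \ (a ∪ b)`, a colour
  of `P` that is NOT a colour of `A` (fresh);
* the remaining members `X ⊆ A` (minimal in `P`, i.e. isolated, with `F \ a ∉ rainbowMeets F A`) are paid by the AVAILABLE colours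
  `availColours F A X` = colours `t` of `A` with `F \ t ∉ A` that are either strictly inside some member of `X` or strictly inside no
  member of `A` at all — these can neither be a member of `Low` (a member of `Low` lies strictly below a maximal member, but not
  below a minimal one) nor the complement of a member.
Hence (`card_le_card_rainbowMeets_of_avail`) **RAINBOW(P) ⟸ `#X ≤ #availColours F A X`**, a Hall-type condition on the antichain
`A` alone, and:
* `AntichainAvailHall` (typed, [status: open]): for every complement-free antichain `A` and every `X ⊆ A` whose members' complements
  are not colours of `A`, `#X ≤ #availColours F A X`.  EVIDENCE (engines `prim-masterthm-p1/code-g39/`): TRUE for every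
  complement-free family of `2^5` in its original form (43 046 720 families, `acc1.c`), for EVERY pair `(A, X)` over all
  3 201 002 complement-free antichains of `2^6` (556 194 881 pairs, `hall3.c`), and for random / structured antichains (blow-ups,
  products, sunflower-like) of `2^7 … 2^12` (kit job `j294719`, matching form `acc2big.c`); tight (equality) only for `#X ≤ 2`;
  the minimal slack by `#X` (0,0,1,1,3,4,6,7,7 on `2^5`) coincides with the minimal rainbow slack of antichains.
* `rainbowMeetCojoin_of_antichainAvailHall`: **`AntichainAvailHall ⟹ RainbowMeetCojoin`**.
* UNCONDITIONAL (`card_le_card_rainbowMeets_of_generic`): the rainbow lemma holds for every complement-free family whose maximal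
  members are in GENERIC POSITION — no maximal member is the complement of a colour of the maximal antichain, and no complemented
  join of two maximal members lies strictly inside a maximal member — because then `availColours ⊇ rainbowMeets F X` and the
  antichain rainbow lemma (`card_le_card_rainbowMeets_of_antichain`, gen 38) pays `X`.
HONEST FRAMING: `AntichainAvailHall` and `RainbowMeetCojoin` remain OPEN; the reductions and the generic-position theorem are
unconditional. [this work]
-/

namespace Summit.CriticalPhenomena.PercolationContinuityZ3.Theorems.SahiColouredDaykin

open Finset

variable {α : Type*} [DecidableEq α]

/-! ### 1. Maximal members -/

/-- The MAXIMAL members of a set family: those not strictly contained in another member. [this work] -/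
def maxMembers (P : Finset (Finset α)) : Finset (Finset α) :=
  P.filter fun a => ∀ b ∈ P, a ⊆ b → b ⊆ a

/-- Unpacking `maxMembers`. [this work] -/
theorem mem_maxMembers_iff {P : Finset (Finset α)} {a : Finset α} :
    a ∈ maxMembers P ↔ a ∈ P ∧ ∀ b ∈ P, a ⊆ b → b ⊆ a := by
  unfold maxMembers; rw [mem_filter]

/-- Maximal members are members. [this work] -/
theorem maxMembers_subset (P : Finset (Finset α)) : maxMembers P ⊆ P := filter_subset _ _

/-- The maximal members form an antichain. [this work] -/
theorem isAntichain_maxMembers (P : Finset (Finset α)) :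
    IsAntichain (· ⊆ ·) (maxMembers P : Set (Finset α)) := by
  intro a ha b hb hab h
  have ha' := mem_maxMembers_iff.1 (mem_coe.1 ha)
  have hb' := mem_maxMembers_iff.1 (mem_coe.1 hb)
  exact hab (Subset.antisymm h (ha'.2 b hb'.1 h))

/-- Every member lies below some maximal member. [this work] -/
theorem exists_mem_maxMembers_subset {P : Finset (Finset α)} {b : Finset α} (hb : b ∈ P) :
    ∃ m ∈ maxMembers P, b ⊆ m := by
  obtain ⟨m, hbm, hm⟩ := P.exists_le_maximal hb
  exact ⟨m, mem_maxMembers_iff.2 ⟨hm.1, fun c hc hmc => hm.2 hc hmc⟩, hbm⟩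

/-- A non-maximal member lies STRICTLY below some maximal member. [this work] -/
theorem exists_mem_maxMembers_ssubset {P : Finset (Finset α)} {b : Finset α} (hb : b ∈ P) (hb' : b ∉ maxMembers P) :
    ∃ m ∈ maxMembers P, b ⊂ m := by
  obtain ⟨m, hm, hbm⟩ := exists_mem_maxMembers_subset hb
  refine ⟨m, hm, Finset.ssubset_iff_subset_ne.2 ⟨hbm, ?_⟩⟩
  rintro rfl
  exact hb' hm

/-! ### 2. Available colours and the typed Hall condition -/

/-- The colours of the antichain `A` AVAILABLE to the sub-family `X`: rainbow meets `t` of `A` whose complement is not a member of `A`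
and which lie strictly inside some member of `X` or strictly inside no member of `A`. [this work] -/
def availColours (F : Finset α) (A X : Finset (Finset α)) : Finset (Finset α) :=
  (rainbowMeets F A).filter fun t => F \ t ∉ A ∧ ((∀ a ∈ A, ¬ t ⊂ a) ∨ ∃ x ∈ X, t ⊂ x)

/-- Unpacking `availColours`. [this work] -/
theorem mem_availColours_iff {F : Finset α} {A X : Finset (Finset α)} {t : Finset α} :
    t ∈ availColours F A X ↔ t ∈ rainbowMeets F A ∧ F \ t ∉ A ∧ ((∀ a ∈ A, ¬ t ⊂ a) ∨ ∃ x ∈ X, t ⊂ x) := by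
  unfold availColours; rw [mem_filter]

/-- Available colours are colours of `A`. [this work] -/
theorem availColours_subset (F : Finset α) (A X : Finset (Finset α)) : availColours F A X ⊆ rainbowMeets F A :=
  filter_subset _ _

/-- **CONJECTURE (Hall condition for the available colours of an antichain; typed).**  For a complement-free antichain `A ⊆ 2^F`
and every `X ⊆ A` none of whose members has its complement among the colours of `A`, the colours available to `X` number at
least `#X`.  Exhaustively true on `2^5` and `2^6` (all pairs `(A, X)`), and on random and structured antichains of `2^7 … 2^12`
(file header); implies the rainbow lemma (`rainbowMeetCojoin_of_antichainAvailHall`). [this work] [status: open] -/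
@[conjecture] def AntichainAvailHall (α : Type*) [DecidableEq α] : Prop :=
  ∀ (F : Finset α) (A X : Finset (Finset α)),
    (∀ a ∈ A, a ⊆ F) → (∀ a ∈ A, F \ a ∉ A) → IsAntichain (· ⊆ ·) (A : Set (Finset α)) →
    X ⊆ A → (∀ x ∈ X, F \ x ∉ rainbowMeets F A) → #X ≤ #(availColours F A X)

/-! ### 3. The reduction -/

section Reduction

variable {F : Finset α} {P : Finset (Finset α)}

/-- The members of `P` to be paid by available colours: maximal members that are minimal in `P` and whose complement is not a
colour of the maximal antichain. [this work] -/
def hardMembers (F : Finset α) (P : Finset (Finset α)) : Finset (Finset α) :=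
  (maxMembers P).filter fun a => (∀ b ∈ P, ¬ b ⊂ a) ∧ F \ a ∉ rainbowMeets F (maxMembers P)

/-- Unpacking `hardMembers`. [this work] -/
theorem mem_hardMembers_iff {a : Finset α} :
    a ∈ hardMembers F P ↔ a ∈ maxMembers P ∧ (∀ b ∈ P, ¬ b ⊂ a) ∧ F \ a ∉ rainbowMeets F (maxMembers P) := by
  unfold hardMembers; rw [mem_filter]

/-- Hard members are maximal members. [this work] -/
theorem hardMembers_subset (F : Finset α) (P : Finset (Finset α)) : hardMembers F P ⊆ maxMembers P := filter_subset _ _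

/-- **THE MAX-ANTICHAIN ACCOUNTING.**  If the hard members of a complement-free family `P ⊆ 2^F` are outnumbered by their available
colours in the maximal antichain, then `P` satisfies the rainbow lemma.  The colouring: a non-maximal member `l` gets `l` itself; a
maximal member that is not hard gets its complement; the hard members share the available colours; the three colour classes are
pairwise disjoint subsets of `rainbowMeets F P`. [this work] -/
theorem card_le_card_rainbowMeets_of_avail (hPF : ∀ S ∈ P, S ⊆ F) (hcf : ∀ S ∈ P, F \ S ∉ P)
    (h : #(hardMembers F P) ≤ #(availColours F (maxMembers P) (hardMembers F P))) :
    #P ≤ #(rainbowMeets F P) := by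
  set A := maxMembers P with hA
  set X := hardMembers F P with hX
  have hAP : A ⊆ P := maxMembers_subset P
  have hXA : X ⊆ A := hardMembers_subset F P
  -- class 1: the non-maximal members are their own colours
  have h₁ : P \ A ⊆ rainbowMeets F P := by
    intro l hl
    obtain ⟨hlP, hlA⟩ := mem_sdiff.1 hl
    obtain ⟨m, hm, hlm⟩ := exists_mem_maxMembers_ssubset hlP hlA
    have e : l ∩ m = l := inter_eq_left.2 hlm.1
    rw [← e]
    exact inter_mem_rainbowMeets hlP (hAP hm) (Finset.ssubset_iff_subset_ne.1 hlm).2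
  -- class 2: complements of the maximal members that are not hard
  have h₂ : (A \ X).image (F \ ·) ⊆ rainbowMeets F P := by
    intro t ht
    obtain ⟨a, ha, rfl⟩ := mem_image.1 ht
    obtain ⟨haA, haX⟩ := mem_sdiff.1 ha
    by_cases hb : ∃ b ∈ P, b ⊂ a
    · obtain ⟨b, hbP, hba⟩ := hb
      have e : a ∪ b = a := union_eq_left.2 hba.1
      have : F \ (a ∪ b) ∈ rainbowMeets F P :=
        sdiff_union_mem_rainbowMeets (hAP haA) hbP (Finset.ssubset_iff_subset_ne.1 hba).2.symm
      rwa [e] at this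
    · push Not at hb
      have : F \ a ∈ rainbowMeets F A := by
        by_contra hna
        exact haX (mem_hardMembers_iff.2 ⟨haA, hb, hna⟩)
      exact rainbowMeets_mono F hAP this
  -- class 3: the available colours
  have h₃ : availColours F A X ⊆ rainbowMeets F P :=
    fun t ht => rainbowMeets_mono F hAP (availColours_subset F A X ht)
  -- pairwise disjointness
  have d₁₂ : Disjoint (P \ A) ((A \ X).image (F \ ·)) := by
    rw [disjoint_left]
    intro l hl hl'
    obtain ⟨a, ha, hal⟩ := mem_image.1 hl'
    have hlP : F \ a ∈ P := by rw [hal]; exact (mem_sdiff.1 hl).1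
    exact hcf a (hAP (mem_sdiff.1 ha).1) hlP
  have d₁₃ : Disjoint (P \ A) (availColours F A X) := by
    rw [disjoint_left]
    intro l hl hl'
    obtain ⟨hlP, hlA⟩ := mem_sdiff.1 hl
    obtain ⟨m, hm, hlm⟩ := exists_mem_maxMembers_ssubset hlP hlA
    obtain ⟨_, _, hor⟩ := mem_availColours_iff.1 hl'
    rcases hor with hno | ⟨x, hx, hlx⟩
    · exact hno m hm hlm
    · exact (mem_hardMembers_iff.1 hx).2.1 l hlP hlx
  have d₂₃ : Disjoint ((A \ X).image (F \ ·)) (availColours F A X) := by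
    rw [disjoint_left]
    intro t ht ht'
    obtain ⟨a, ha, rfl⟩ := mem_image.1 ht
    have haP := hAP (mem_sdiff.1 ha).1
    have e : F \ (F \ a) = a := Finset.sdiff_sdiff_eq_self (hPF a haP)
    have hna := (mem_availColours_iff.1 ht').2.1
    rw [e] at hna
    exact hna (mem_sdiff.1 ha).1
  -- complementation is injective on members
  have hinj : Set.InjOn (fun a : Finset α => F \ a) ↑(A \ X) := by
    intro a ha b hb hab
    have haF := hPF a (hAP (mem_sdiff.1 (mem_coe.1 ha)).1)
    have hbF := hPF b (hAP (mem_sdiff.1 (mem_coe.1 hb)).1)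
    have hab' : F \ a = F \ b := hab
    rw [← Finset.sdiff_sdiff_eq_self haF, hab', Finset.sdiff_sdiff_eq_self hbF]
  -- counting
  have hunion : (P \ A ∪ (A \ X).image (F \ ·)) ∪ availColours F A X ⊆ rainbowMeets F P :=
    union_subset (union_subset h₁ h₂) h₃
  have c₂ : #((A \ X).image (F \ ·)) = #(A \ X) := card_image_of_injOn hinj
  have cPA : #(P \ A) + #A = #P := card_sdiff_add_card_eq_card hAP
  have cAX : #(A \ X) + #X = #A := card_sdiff_add_card_eq_card hXA
  have cU : #((P \ A ∪ (A \ X).image (F \ ·)) ∪ availColours F A X) =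
      #(P \ A) + #((A \ X).image (F \ ·)) + #(availColours F A X) := by
    rw [card_union_of_disjoint (disjoint_union_left.2 ⟨d₁₃, d₂₃⟩), card_union_of_disjoint d₁₂]
  have := card_le_card hunion
  omega

/-- **`AntichainAvailHall ⟹ RainbowMeetCojoin`** (the rainbow lemma). [this work] -/
theorem rainbowMeetCojoin_of_antichainAvailHall (h : AntichainAvailHall α) : RainbowMeetCojoin α := by
  intro F P hPF hcf
  have hAP := maxMembers_subset P
  exact card_le_card_rainbowMeets_of_avail hPF hcf
    (h F (maxMembers P) (hardMembers F P) (fun a ha => hPF a (hAP ha)) (fun a ha h' => hcf a (hAP ha) (hAP h'))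
      (isAntichain_maxMembers P) (hardMembers_subset F P) (fun x hx => (mem_hardMembers_iff.1 hx).2.2))

end Reduction

/-! ### 4. Generic position: an unconditional instance -/

section Generic

variable {F : Finset α} {P : Finset (Finset α)}

/-- **The rainbow lemma in generic position.**  If no maximal member of the complement-free family `P ⊆ 2^F` is the complement of a
colour of the maximal antichain, and no complemented join of two maximal members lies strictly inside a maximal member, then
`#P ≤ #rainbowMeets F P`: every rainbow meet of the hard members is available, and the antichain rainbow lemma
(`card_le_card_rainbowMeets_of_antichain`) pays them. [this work] -/
theorem card_le_card_rainbowMeets_of_generic (hPF : ∀ S ∈ P, S ⊆ F) (hcf : ∀ S ∈ P, F \ S ∉ P)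
    (hG1 : ∀ a ∈ maxMembers P, F \ a ∉ rainbowMeets F (maxMembers P))
    (hG2 : ∀ a ∈ maxMembers P, ∀ b ∈ maxMembers P, ∀ c ∈ maxMembers P, b ≠ c → ¬ F \ (b ∪ c) ⊂ a) :
    #P ≤ #(rainbowMeets F P) := by
  apply card_le_card_rainbowMeets_of_avail hPF hcf
  set A := maxMembers P with hA
  set X := hardMembers F P with hX
  have hAP : A ⊆ P := maxMembers_subset P
  have hXA : X ⊆ A := hardMembers_subset F P
  have hXF : ∀ S ∈ X, S ⊆ F := fun S hS => hPF S (hAP (hXA hS))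
  have hXcf : ∀ S ∈ X, F \ S ∉ X := fun S hS h' => hcf S (hAP (hXA hS)) (hAP (hXA h'))
  have hAanti : IsAntichain (· ⊆ ·) (A : Set (Finset α)) := isAntichain_maxMembers P
  have hXanti : IsAntichain (· ⊆ ·) (X : Set (Finset α)) := hAanti.subset (coe_subset.2 hXA)
  rcases X.eq_empty_or_nonempty with hX0 | ⟨x₀, hx₀⟩
  · rw [hX0, card_empty]; exact Nat.zero_le _
  refine (card_le_card_rainbowMeets_of_antichain F X hXF hXcf hXanti).trans (card_le_card ?_)
  -- every rainbow meet of `X` is available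
  have hFA : F ∉ A := fun hF => hG1 F hF (by rw [sdiff_self]; exact mem_rainbowMeets_iff.2 (Or.inl rfl))
  -- the empty colour is available
  have h0 : (∅ : Finset α) ∈ availColours F A X := by
    refine mem_availColours_iff.2 ⟨mem_rainbowMeets_iff.2 (Or.inl rfl), by rw [sdiff_empty]; exact hFA, ?_⟩
    by_cases hne : ∃ x ∈ X, (∅ : Finset α) ⊂ x
    · exact Or.inr hne
    · push Not at hne
      left
      -- every hard member is empty, so `∅` is a maximal member and the only member
      have hx0 : x₀ = ∅ := by
        by_contra h'
        exact hne x₀ hx₀ (empty_ssubset.2 (nonempty_iff_ne_empty.2 h'))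
      intro a ha
      have h0A : (∅ : Finset α) ∈ A := hx0 ▸ hXA hx₀
      have : a ⊆ ∅ := (mem_maxMembers_iff.1 h0A).2 a (hAP ha) (empty_subset a)
      rw [subset_empty.1 this]
      exact fun h => (Finset.ssubset_iff_subset_ne.1 h).2 rfl
  intro t ht
  rcases mem_rainbowMeets_iff.1 ht with rfl | ⟨x, hx, y, hy, hxy, rfl | rfl⟩
  · exact h0
  · -- a meet `x ∩ y`: strictly inside `x`, and its complement is not a member by (G1)
    refine mem_availColours_iff.2 ⟨inter_mem_rainbowMeets (hXA hx) (hXA hy) hxy, fun hmem => ?_, Or.inr ⟨x, hx, ?_⟩⟩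
    · apply hG1 _ hmem
      rw [Finset.sdiff_sdiff_eq_self ((inter_subset_left).trans (hXF x hx))]
      exact inter_mem_rainbowMeets (hXA hx) (hXA hy) hxy
    · refine Finset.ssubset_iff_subset_ne.2 ⟨inter_subset_left, fun e => ?_⟩
      exact hXanti (mem_coe.2 hx) (mem_coe.2 hy) hxy (inter_eq_left.1 e)
  · -- a complemented join `F \ (x ∪ y)`: its complement `x ∪ y` is not a member, and by (G2) it lies strictly inside no member
    refine mem_availColours_iff.2 ⟨sdiff_union_mem_rainbowMeets (hXA hx) (hXA hy) hxy, fun hmem => ?_,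
      Or.inl fun a ha => hG2 a ha x (hXA hx) y (hXA hy) hxy⟩
    rw [Finset.sdiff_sdiff_eq_self (union_subset (hXF x hx) (hXF y hy))] at hmem
    have e : x = x ∪ y := by
      by_contra hne
      exact hAanti (mem_coe.2 (hXA hx)) (mem_coe.2 hmem) hne subset_union_left
    have : y ⊆ x := by rw [e]; exact subset_union_right
    exact hXanti (mem_coe.2 hy) (mem_coe.2 hx) (Ne.symm hxy) this

end Generic

end Summit.CriticalPhenomena.PercolationContinuityZ3.Theorems.SahiColouredDaykin
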